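import Literature.NumberTheory.LFunctions.DedekindZetaNonvanishing
import Mathlib.Analysis.ODE.Gronwall
import HarnessLib

/-!
# `1/ζ_K(s) ≪ log(|t|+4)` and `ζ_K'/ζ_K(s) + 1/(s−1) ≪ log(|t|+4)` in the classical zero-free region

Topic `Literature/NumberTheory/LFunctions`, next to `ClassicalZeroFreeRegion.lean` (the abstract
de la Vallée-Poussin–Landau package `ClassicalZFRData Λ G η`, Montgomery–Vaughan Theorems 6.6–6.7)
and `DedekindZetaNonvanishing.lean` (its specialisation to the continued Dedekind zeta function
`dedekindZetaCont K`). Everything in this file is PROVED; there are no named facts.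

Montgomery–Vaughan, *Multiplicative Number Theory I*, Theorem 6.7 states three estimates in the
region `σ ≥ 1 − c/log τ` (`τ = |t| + 4`): `ζ'/ζ(s) + 1/(s−1) ≪ log τ`, `|log ζ(s)(s−1)| ≪ …` and
**`1/ζ(s) ≪ log τ`** ((6.7)); p. 267 ibid.: "as in Chapter 6 we may derive" the same for `ζ_K`.
The tree's `ClassicalZFRData.norm_logDeriv_le` proves the first for an abstract pair `(Λ, G)`
(`G = (s − 1)ζ_K(s)`); this file adds the bound for `1/ζ`, in the abstract setting and for every
number field:

* `ClassicalZFRData.norm_le_norm_mul_exp_of_deriv_le` — Grönwall along a horizontal segment inside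
  the domain of holomorphy (Titchmarsh (3.11.6)–(3.11.8));
* `ClassicalZFRData.exists_norm_sub_one_div_le` — **MV Theorem 6.7 (6.7), abstract form**: under
  `ClassicalZFRData Λ G η` there are `c > 0`, `C > 0` with `G(s) ≠ 0`,
  `‖(s − 1)/G(s)‖ ≤ C log(|t|+4)` and `‖G'/G(s)‖ ≤ C log(|t|+4)` for `1 − η < σ`,
  `1 − c/log(|t|+4) ≤ σ ≤ 2` (for `G = (s−1)ζ`, `(s−1)/G = 1/ζ`);
* the entire function `ζ_K,₁(s) = (s − 1)·ζ_K(s)` (value `ρ_K` at `s = 1`), written, as in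
  `DedekindZetaNonvanishing.lean`, `Function.update (fun s ↦ (s − 1) * dedekindZetaCont K s) 1 ρ_K`
  (local notation `ζ₁[K]`; no definition is introduced): `differentiable_dedekindZeta₁` (it is
  entire), `classicalZFRData_dedekindZeta₁`, `dedekindZeta₁_growth`;
* `NumberField.dedekindZeta₁_classicalRegion_bounds` — for every number field `K`: `c > 0`, `C > 0`
  with `ζ_K,₁(s) ≠ 0`, `‖(s−1)/ζ_K,₁(s)‖ ≤ C log(|t|+4)`, `‖ζ_K,₁'/ζ_K,₁(s)‖ ≤ C log(|t|+4)`
  whenever `1 − c/log(|t|+4) ≤ σ ≤ 2` (the form used in contour arguments: `ζ_K,₁` is entire);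
* `NumberField.dedekindZetaCont_classicalRegion_bounds` — **MV Theorem 6.7 for `ζ_K`** (p. 267):
  for `s ≠ 1` with `1 − c/log(|t|+4) ≤ σ ≤ 2`: `ζ_K(s) ≠ 0`, `‖1/ζ_K(s)‖ ≤ C log(|t|+4)` and
  `‖ζ_K'/ζ_K(s) + 1/(s−1)‖ ≤ C log(|t|+4)`, `ζ_K = dedekindZetaCont K`.

These are the inputs of Perron-formula evaluations of sums of `μ_K`-type coefficients
(Dirichlet series `H(s)/ζ_K(s)`), e.g. D. R. Heath-Brown, *Primes represented by `x³ + 2y³`*, Acta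
Math. 186 (2001), p. 51 ((8.7), "using the standard zero-free region for `ζ_K(s)` we may change
the path of integration") and p. 63 ("so that one has `ζ_K(s+1)⁻¹ ≪ log(2+|s|)` to the right of
the path").

## Proof (MV p. 173, Titchmarsh §3.11)

With `L = log(|t|+4)` and `σ₁ = 1 + 1/L`: for `σ ≥ σ₁` the lower bound
`|G(s)| ≥ c₁(σ−1)|s−1|` right of `1` (`ClassicalZFRData.norm_apply_ge`, from `Λ ≥ 0`) gives
`|(s−1)/G(s)| ≤ L/c₁`; for `1 − c/L ≤ σ < σ₁`, `|G'/G| ≤ C L` on the segment `[σ, σ₁] + it`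
(`ClassicalZFRData.norm_logDeriv_le`), so Grönwall's inequality gives
`|G(σ₁+it)| ≤ |G(σ+it)| e^{C(1+c)}`, while `|G(σ₁+it)| ≥ (c₁/L)|σ₁−1+it|` and
`|s − 1| ≤ (2+c)|σ₁−1+it|`.

## References

* H. L. Montgomery, R. C. Vaughan, *Multiplicative Number Theory I. Classical Theory*, CUP 2007,
  §6.1 Theorem 6.7 (6.7), p. 173; §8.4 p. 267. [cite: MontgomeryVaughan2007, Theorem 6.7]
* E. C. Titchmarsh, *The Theory of the Riemann Zeta-Function*, 2nd ed. (1986), Theorem 3.11,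
  (3.11.6)–(3.11.8). [cite: Titchmarsh1986, Theorem 3.11]
* E. Landau, *Neuer Beweis des Primzahlsatzes und Beweis des Primidealsatzes*, Math. Ann. 56
  (1903), 645–670, Part II. [cite: LandauMathAnn1903, Part II]

## Mathlib / tree search

Mathlib: `norm_le_gronwallBound_of_norm_deriv_right_le`, `gronwallBound_ε0`,
`Complex.differentiableOn_compl_singleton_and_continuousAt_iff`. Tree: `ClassicalZFRData`
(`zeroFree`, `norm_logDeriv_le`, `norm_apply_ge`), `ZetaClassicalRegion.exists_zeroFreeRegion_bounds`
(the same three bounds for `riemannZeta`, whose Grönwall step is followed here),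
`NumberField.isLandauContinuation_dedekindZetaCont_holds'`, `classicalZFRData_of_isLandauContinuation`,
`exists_isLandauContinuation_holds`; no `1/ζ_K` bound in the tree
(`lean search 'dedekindZeta.*inv|inv.*dedekindZeta|norm_sub_one_div'`).
-/

noncomputable section

open Complex Filter Set Topology

namespace Literature.NumberTheory.LFunctions

namespace ClassicalZFRData

variable {Λ : ℕ → ℝ} {G : ℂ → ℂ} {η : ℝ}

/-- **Grönwall along a horizontal segment** inside an open set of holomorphy: if
`‖G'(u + it)‖ ≤ K ‖G(u + it)‖` for `σ ≤ u < σ₁` and the closed segment lies in `U`, then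
`‖G(σ₁ + it)‖ ≤ ‖G(σ + it)‖ e^{K(σ₁ − σ)}` (Titchmarsh's integration of the logarithmic
derivative). [cite: Titchmarsh1986, Theorem 3.11 eq. (3.11.6) to (3.11.8)] -/
theorem norm_le_norm_mul_exp_of_deriv_le {U : Set ℂ} (hU : IsOpen U) (hG : DifferentiableOn ℂ G U)
    {σ σ₁ t K : ℝ} (hσ : σ ≤ σ₁) (hmem : ∀ u ∈ Icc σ σ₁, (u : ℂ) + t * I ∈ U)
    (hb : ∀ u ∈ Ico σ σ₁, ‖deriv G (u + t * I)‖ ≤ K * ‖G (u + t * I)‖) :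
    ‖G (σ₁ + t * I)‖ ≤ ‖G (σ + t * I)‖ * Real.exp (K * (σ₁ - σ)) := by
  set f : ℝ → ℂ := fun u ↦ G (u + t * I) with hfdef
  have hderiv : ∀ u ∈ Icc σ σ₁, HasDerivAt f (deriv G (u + t * I)) u := by
    intro u hu
    have h1 : HasDerivAt (fun z : ℂ ↦ z + t * I) 1 (u : ℂ) := (hasDerivAt_id (u : ℂ)).add_const _
    have h2 : HasDerivAt G (deriv G (u + t * I)) ((u : ℂ) + t * I) :=
      (hG.differentiableAt (hU.mem_nhds (hmem u hu))).hasDerivAt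
    have h3 := h2.comp (u : ℂ) h1
    rw [mul_one] at h3
    exact h3.comp_ofReal
  have hcont : ContinuousOn f (Icc σ σ₁) := fun u hu ↦
    (hderiv u hu).continuousAt.continuousWithinAt
  have hGr := norm_le_gronwallBound_of_norm_deriv_right_le (f := f)
    (f' := fun u ↦ deriv G (u + t * I)) (δ := ‖f σ‖) (K := K) (ε := 0) (a := σ) (b := σ₁)
    hcont (fun u hu ↦ (hderiv u (Ico_subset_Icc_self hu)).hasDerivWithinAt) le_rfl
    (fun u hu ↦ by rw [add_zero]; exact hb u hu)
  have h := hGr σ₁ (right_mem_Icc.2 hσ)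
  rwa [gronwallBound_ε0] at h

section Consequences

variable (h : ClassicalZFRData Λ G η)
include h

/-- **Montgomery–Vaughan Theorem 6.7, (6.7), abstract form: `1/ζ ≪ log τ` in the classical
region.** Under `ClassicalZFRData Λ G η` there are `c > 0` and `C > 0` such that for all `s` with
`1 − η < σ`, `1 − c/log(|t|+4) ≤ σ ≤ 2`: `G(s) ≠ 0`, `‖(s − 1)/G(s)‖ ≤ C log(|t|+4)` and
`‖G'(s)/G(s)‖ ≤ C log(|t|+4)` (for `G = (s − 1)ζ_K(s)`: `(s − 1)/G = 1/ζ_K` and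
`G'/G = ζ_K'/ζ_K + 1/(s−1)`). [cite: MontgomeryVaughan2007, Theorem 6.7] -/
theorem exists_norm_sub_one_div_le : ∃ c : ℝ, 0 < c ∧ ∃ C : ℝ, 0 < C ∧ ∀ s : ℂ, 1 - η < s.re →
    1 - c / Real.log (|s.im| + 4) ≤ s.re → s.re ≤ 2 →
      G s ≠ 0 ∧ ‖(s - 1) / G s‖ ≤ C * Real.log (|s.im| + 4) ∧
        ‖deriv G s / G s‖ ≤ C * Real.log (|s.im| + 4) := by
  obtain ⟨c, hc, C, hC, hld⟩ := h.norm_logDeriv_le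
  obtain ⟨c₁, hc₁, hlow⟩ := h.norm_apply_ge
  set C' : ℝ := max (max C (1 / c₁)) ((2 + c) * Real.exp (C * (1 + c)) / c₁) with hC'def
  have hC'1 : C ≤ C' := (le_max_left _ _).trans (le_max_left _ _)
  have hC'2 : 1 / c₁ ≤ C' := (le_max_right _ _).trans (le_max_left _ _)
  have hC'3 : (2 + c) * Real.exp (C * (1 + c)) / c₁ ≤ C' := le_max_right _ _
  have hC'pos : 0 < C' := lt_of_lt_of_le (by positivity) hC'2
  refine ⟨c, hc, C', hC'pos, fun s hsη hsc hs2 ↦ ?_⟩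
  set σ : ℝ := s.re with hσdef
  set t : ℝ := s.im with htdef
  set L : ℝ := Real.log (|t| + 4) with hLdef
  have hL1 : 1 ≤ L := one_le_log_tau t
  have hL0 : 0 < L := log_tau_pos t
  have hs_eq : (σ : ℂ) + t * I = s := re_add_im s
  obtain ⟨hG0, hlds⟩ := hld s hsη hsc
  refine ⟨hG0, ?_, hlds.trans (by gcongr)⟩
  set σ₁ : ℝ := 1 + 1 / L with hσ₁def
  have hσ₁1 : σ₁ - 1 = 1 / L := by rw [hσ₁def]; ring
  have hσ₁gt : 1 < σ₁ := by rw [hσ₁def]; linarith [one_div_pos.2 hL0]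
  have hσ₁2 : σ₁ ≤ 2 := by
    rw [hσ₁def]
    have : 1 / L ≤ 1 := by rw [div_le_one hL0]; exact hL1
    linarith
  by_cases hcase : σ₁ ≤ σ
  · -- to the right of `σ₁`: `|G(s)| ≥ c₁ (σ − 1)|s − 1|`, `σ − 1 ≥ 1/L`
    have h1 : 1 < s.re := hσ₁gt.trans_le hcase
    have hG := hlow s h1 hs2
    have hs1 : s - 1 ≠ 0 := by
      intro h0
      have := congrArg Complex.re h0
      simp at this
      linarith
    have hn : 0 < ‖s - 1‖ := norm_pos_iff.2 hs1
    have hGpos : 0 < ‖G s‖ := norm_pos_iff.2 hG0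
    rw [norm_div, div_le_iff₀ hGpos]
    have hσ1 : 1 / L ≤ σ - 1 := by rw [← hσ₁1]; linarith
    calc ‖s - 1‖ = (1 / c₁ * L) * (c₁ * (1 / L) * ‖s - 1‖) := by field_simp
      _ ≤ (C' * L) * (c₁ * (s.re - 1) * ‖s - 1‖) := by gcongr
      _ ≤ C' * Real.log (|s.im| + 4) * ‖G s‖ := by
          rw [← hLdef]; exact mul_le_mul_of_nonneg_left hG (by positivity)
  · -- `σ < σ₁`: Grönwall on `[σ, σ₁] + it`
    push Not at hcase
    set s₁ : ℂ := (σ₁ : ℂ) + t * I with hs₁def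
    have hs₁re : s₁.re = σ₁ := by simp [hs₁def]
    have hs₁im : s₁.im = t := by simp [hs₁def]
    -- the segment lies in the region
    have hseg : ∀ u ∈ Icc σ σ₁, G (u + t * I) ≠ 0 ∧
        ‖deriv G (u + t * I) / G (u + t * I)‖ ≤ C * L := by
      intro u hu
      have hre : ((u : ℂ) + t * I).re = u := by simp
      have him : ((u : ℂ) + t * I).im = t := by simp
      have := hld ((u : ℂ) + t * I) (by rw [hre]; linarith [hu.1]) (by rw [hre, him]; linarith [hu.1])
      rwa [him] at this
    have hb : ∀ u ∈ Ico σ σ₁, ‖deriv G (u + t * I)‖ ≤ (C * L) * ‖G (u + t * I)‖ := by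
      intro u hu
      obtain ⟨h0, hq⟩ := hseg u (Ico_subset_Icc_self hu)
      calc ‖deriv G (u + t * I)‖
          = ‖deriv G (u + t * I) / G (u + t * I)‖ * ‖G (u + t * I)‖ := by
            rw [← norm_mul, div_mul_cancel₀ _ h0]
        _ ≤ (C * L) * ‖G (u + t * I)‖ := mul_le_mul_of_nonneg_right hq (norm_nonneg _)
    have hgr := norm_le_norm_mul_exp_of_deriv_le (isOpen_dom η) h.differentiableOn hcase.le
      (fun u hu ↦ by
        show ((u : ℂ) + t * I) ∈ {s : ℂ | 1 - η < s.re}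
        simp only [Set.mem_setOf_eq, add_re, ofReal_re, mul_re, I_re, mul_zero, ofReal_im,
          I_im, mul_one, sub_self, add_zero]
        linarith [hu.1]) hb
    rw [hs_eq] at hgr
    -- the exponent: `C L (σ₁ − σ) ≤ C (1 + c)`
    have hexp : Real.exp (C * L * (σ₁ - σ)) ≤ Real.exp (C * (1 + c)) := by
      apply Real.exp_le_exp.2
      have h1 : σ₁ - σ ≤ 1 / L + c / L := by rw [hσ₁def]; linarith
      calc C * L * (σ₁ - σ) ≤ C * L * (1 / L + c / L) := by gcongr
        _ = C * (1 + c) := by field_simp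
    -- lower bound at `s₁`
    have hlow₁ : c₁ * (1 / L) * ‖s₁ - 1‖ ≤ ‖G s₁‖ := by
      have := hlow s₁ (by rw [hs₁re]; exact hσ₁gt) (by rw [hs₁re]; exact hσ₁2)
      rwa [hs₁re, hσ₁1] at this
    -- `|s − 1| ≤ (2 + c)|s₁ − 1|`
    have hs₁1 : 1 / L ≤ ‖s₁ - 1‖ := by
      have := Complex.abs_re_le_norm (s₁ - 1)
      rw [sub_re, hs₁re, one_re, hσ₁1] at this
      exact (le_abs_self _).trans this
    have hdist : ‖s - 1‖ ≤ (2 + c) * ‖s₁ - 1‖ := by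
      have h1 : s - 1 = (s₁ - 1) - ((σ₁ - σ : ℝ) : ℂ) := by
        rw [← hs_eq, hs₁def]; push_cast; ring
      have h2 : ‖((σ₁ - σ : ℝ) : ℂ)‖ = σ₁ - σ := by
        rw [Complex.norm_real, Real.norm_of_nonneg (by linarith)]
      have h3 : σ₁ - σ ≤ (1 + c) * (1 / L) := by
        rw [hσ₁def]
        have : (1 + c) * (1 / L) = 1 / L + c / L := by ring
        linarith
      calc ‖s - 1‖ ≤ ‖s₁ - 1‖ + ‖((σ₁ - σ : ℝ) : ℂ)‖ := by rw [h1]; exact norm_sub_le _ _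
        _ ≤ ‖s₁ - 1‖ + (1 + c) * ‖s₁ - 1‖ := by
            have h4 : σ₁ - σ ≤ (1 + c) * ‖s₁ - 1‖ := h3.trans (by gcongr)
            rw [h2]; linarith
        _ = (2 + c) * ‖s₁ - 1‖ := by ring
    -- combine
    have hGpos : 0 < ‖G s‖ := norm_pos_iff.2 hG0
    have hs₁pos : 0 < ‖s₁ - 1‖ := lt_of_lt_of_le (by positivity) hs₁1
    have hE : 0 < Real.exp (C * (1 + c)) := Real.exp_pos _
    rw [norm_div, div_le_iff₀ hGpos]
    -- `c₁ (1/L) |s₁ − 1| ≤ |G s₁| ≤ |G s| e^{C(1+c)}`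
    have hchain : c₁ * (1 / L) * ‖s₁ - 1‖ ≤ ‖G s‖ * Real.exp (C * (1 + c)) :=
      hlow₁.trans (hgr.trans (mul_le_mul_of_nonneg_left hexp hGpos.le))
    calc ‖s - 1‖ ≤ (2 + c) * ‖s₁ - 1‖ := hdist
      _ = ((2 + c) * Real.exp (C * (1 + c)) / c₁ * L) *
            (c₁ * (1 / L) * ‖s₁ - 1‖) / Real.exp (C * (1 + c)) := by
          field_simp
      _ ≤ (C' * L) * (‖G s‖ * Real.exp (C * (1 + c))) / Real.exp (C * (1 + c)) := by
          gcongr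
      _ = C' * Real.log (|s.im| + 4) * ‖G s‖ := by
          rw [← hLdef]; field_simp

end Consequences

end ClassicalZFRData

/-! ## The number-field case: `ζ_K = dedekindZetaCont K` -/

namespace NumberField

variable (K : Type*) [Field K] [NumberField K]

/-- Local notation `ζ₁[K]` for the entire function `ζ_K,₁(s) = (s − 1)·ζ_K(s)` extended by `ρ_K` at
`s = 1`, spelled as in `DedekindZetaNonvanishing.lean` (`isLandauContinuation_dedekindZetaCont_holds'`):
`Function.update (fun s ↦ (s − 1) * dedekindZetaCont K s) 1 ρ_K`. -/
local notation3 "ζ₁[" K "]" =>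
  Function.update (fun s : ℂ ↦ (s - 1) * dedekindZetaCont K s) 1
    ((_root_.NumberField.dedekindZeta_residue K : ℝ) : ℂ)

/-- `ζ_K,₁(1) = ρ_K`. [folklore] -/
theorem dedekindZeta₁_one : ζ₁[K] 1 = (_root_.NumberField.dedekindZeta_residue K : ℂ) := by
  simp

variable {K} in
/-- `ζ_K,₁(s) = (s − 1)·ζ_K(s)` for `s ≠ 1`. [folklore] -/
theorem dedekindZeta₁_eq {s : ℂ} (hs : s ≠ 1) : ζ₁[K] s = (s - 1) * dedekindZetaCont K s := by
  simp [Function.update_of_ne hs]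

/-- **`ζ_K,₁` is entire**: holomorphic off `1` as a product, and continuous at `1` by the residue
statement `(s − 1)ζ_K(s) → ρ_K` (`tendsto_sub_one_mul_dedekindZetaCont_holds`), so the singularity
is removable (`Complex.differentiableOn_compl_singleton_and_continuousAt_iff`). [folklore] -/
theorem differentiable_dedekindZeta₁ : Differentiable ℂ ζ₁[K] := by
  set g : ℂ → ℂ := fun s ↦ (s - 1) * dedekindZetaCont K s with hg
  have hgd : DifferentiableOn ℂ g {1}ᶜ :=
    (differentiableOn_id.sub (differentiableOn_const _)).mul
      (isDedekindZetaContinuation_dedekindZetaCont_holds K).differentiableOn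
  have hGg : EqOn ζ₁[K] g {1}ᶜ := fun s hs ↦ Function.update_of_ne hs _ _
  have hGd : DifferentiableOn ℂ ζ₁[K] Set.univ := by
    rw [← Complex.differentiableOn_compl_singleton_and_continuousAt_iff (c := 1) Filter.univ_mem]
    refine ⟨?_, ?_⟩
    · rw [Set.compl_eq_univ_sdiff] at hgd hGg
      exact hgd.congr hGg
    · rw [continuousAt_update_same]
      exact tendsto_sub_one_mul_dedekindZetaCont_holds K
  exact differentiableOn_univ.1 hGd

/-- Landau's growth bound transported to `ζ_K,₁`: for `δ > 0` there is `C` with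
`‖ζ_K,₁(s)/(s − 1)‖ ≤ C|t|` for `σ ≥ 1 − 1/d + δ`, `|t| ≥ 1` (`exists_isLandauContinuation_holds` and
uniqueness of Landau continuations). [cite: MontgomeryVaughan2007, p. 267] -/
theorem dedekindZeta₁_growth : ∀ δ : ℝ, 0 < δ → ∃ C : ℝ, ∀ s : ℂ,
    1 - 1 / (Module.finrank ℚ K : ℝ) + δ ≤ s.re → 1 ≤ |s.im| →
      ‖ζ₁[K] s / (s - 1)‖ ≤ C * |s.im| := by
  obtain ⟨G₀, hG₀, -, hgr⟩ := exists_isLandauContinuation_holds K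
  intro δ hδ
  obtain ⟨C, hC⟩ := hgr δ hδ
  refine ⟨C, fun s hs ht ↦ ?_⟩
  have hmem : s ∈ landauHalfPlane K := by
    show 1 - 1 / (Module.finrank ℚ K : ℝ) < s.re
    linarith
  rw [(isLandauContinuation_dedekindZetaCont_holds' K).unique hG₀ hmem]
  exact hC s hs ht

/-- `ζ_K,₁` satisfies the hypotheses of the classical zero-free-region argument with
`η = 1/(2d)` (`classicalZFRData_of_isLandauContinuation`). [cite: MontgomeryVaughan2007, p. 267] -/
theorem classicalZFRData_dedekindZeta₁ :
    ClassicalZFRData (vonMangoldtIdeal K) ζ₁[K]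
      (1 / (2 * (Module.finrank ℚ K : ℝ))) :=
  classicalZFRData_of_isLandauContinuation (isLandauContinuation_dedekindZetaCont_holds' K)
    (dedekindZeta₁_one K) (dedekindZeta₁_growth K)

/-- **The three bounds for `ζ_K,₁ = (s−1)ζ_K` in the classical region**: there are `c > 0`, `C > 0`
(depending on `K`) such that for all `s` with `1 − c/log(|t|+4) ≤ σ ≤ 2`: `ζ_K,₁(s) ≠ 0`,
`‖(s − 1)/ζ_K,₁(s)‖ ≤ C log(|t|+4)` and `‖ζ_K,₁'/ζ_K,₁(s)‖ ≤ C log(|t|+4)` (the constant `c` is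
taken `≤ (log 4)/(4d)`, so that the region lies in Landau's half-plane).
[cite: MontgomeryVaughan2007, Theorem 6.7 and p. 267] -/
theorem dedekindZeta₁_classicalRegion_bounds : ∃ c : ℝ, 0 < c ∧ ∃ C : ℝ, 0 < C ∧ ∀ s : ℂ,
    1 - c / Real.log (|s.im| + 4) ≤ s.re → s.re ≤ 2 →
      ζ₁[K] s ≠ 0 ∧ ‖(s - 1) / ζ₁[K] s‖ ≤ C * Real.log (|s.im| + 4) ∧
        ‖deriv ζ₁[K] s / ζ₁[K] s‖ ≤ C * Real.log (|s.im| + 4) := by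
  obtain ⟨c, hc, C, hC, hb⟩ := (classicalZFRData_dedekindZeta₁ K).exists_norm_sub_one_div_le
  set d : ℝ := (Module.finrank ℚ K : ℝ) with hd
  have hd0 : 0 < d := by rw [hd]; exact_mod_cast Module.finrank_pos
  have hlog4 : 0 < Real.log 4 := Real.log_pos (by norm_num)
  refine ⟨min c (Real.log 4 / (4 * d)), lt_min hc (by positivity), C, hC, fun s hσ hs2 ↦ ?_⟩
  have hℓ : Real.log 4 ≤ Real.log (|s.im| + 4) :=
    Real.log_le_log (by norm_num) (by linarith [abs_nonneg s.im])
  have hℓ0 : 0 < Real.log (|s.im| + 4) := hlog4.trans_le hℓ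
  have h1 : min c (Real.log 4 / (4 * d)) / Real.log (|s.im| + 4) ≤ c / Real.log (|s.im| + 4) :=
    div_le_div_of_nonneg_right (min_le_left _ _) hℓ0.le
  have h2 : min c (Real.log 4 / (4 * d)) / Real.log (|s.im| + 4) ≤ 1 / (4 * d) := by
    rw [div_le_iff₀ hℓ0]
    calc min c (Real.log 4 / (4 * d)) ≤ Real.log 4 / (4 * d) := min_le_right _ _
      _ = 1 / (4 * d) * Real.log 4 := by ring
      _ ≤ 1 / (4 * d) * Real.log (|s.im| + 4) := by gcongr
  have h3 : 1 / (4 * d) < 1 / (2 * d) := by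
    rw [one_div_lt_one_div (by positivity) (by positivity)]; linarith
  exact hb s (by linarith) (by linarith) hs2

/-- **Montgomery–Vaughan Theorem 6.7 for the Dedekind zeta function** (p. 267: "as in Chapter 6 we
may derive …"; Landau 1903 for `ζ_κ`): for every number field `K` there are `c > 0`, `C > 0` such
that for all `s ≠ 1` with `1 − c/log(|t|+4) ≤ σ ≤ 2`, writing `ζ_K = dedekindZetaCont K`:
`ζ_K(s) ≠ 0`, `‖1/ζ_K(s)‖ ≤ C log(|t|+4)` and `‖ζ_K'(s)/ζ_K(s) + 1/(s−1)‖ ≤ C log(|t|+4)`.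
[cite: MontgomeryVaughan2007, Theorem 6.7 and p. 267] -/
theorem dedekindZetaCont_classicalRegion_bounds : ∃ c : ℝ, 0 < c ∧ ∃ C : ℝ, 0 < C ∧ ∀ s : ℂ,
    s ≠ 1 → 1 - c / Real.log (|s.im| + 4) ≤ s.re → s.re ≤ 2 →
      dedekindZetaCont K s ≠ 0 ∧ ‖(dedekindZetaCont K s)⁻¹‖ ≤ C * Real.log (|s.im| + 4) ∧
        ‖deriv (dedekindZetaCont K) s / dedekindZetaCont K s + 1 / (s - 1)‖ ≤
          C * Real.log (|s.im| + 4) := by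
  obtain ⟨c, hc, C, hC, hb⟩ := dedekindZeta₁_classicalRegion_bounds K
  refine ⟨c, hc, C, hC, fun s hs1 hσ hs2 ↦ ?_⟩
  obtain ⟨h0, hinv, hld⟩ := hb s hσ hs2
  have hs1' : s - 1 ≠ 0 := sub_ne_zero.2 hs1
  have heq := dedekindZeta₁_eq (K := K) hs1
  have hζ0 : dedekindZetaCont K s ≠ 0 := by
    intro hz
    rw [heq, hz, mul_zero] at h0
    exact h0 rfl
  refine ⟨hζ0, ?_, ?_⟩
  · have : (dedekindZetaCont K s)⁻¹ = (s - 1) / ζ₁[K] s := by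
      rw [heq]; field_simp
    rwa [this]
  · -- `ζ_K,₁' / ζ_K,₁ = 1/(s−1) + ζ_K'/ζ_K` at `s ≠ 1`
    have hζd : DifferentiableAt ℂ (dedekindZetaCont K) s :=
      (isDedekindZetaContinuation_dedekindZetaCont_holds K).differentiableOn.differentiableAt
        (isOpen_compl_singleton.mem_nhds hs1)
    have hev : ζ₁[K] =ᶠ[𝓝 s] fun z ↦ (z - 1) * dedekindZetaCont K z := by
      filter_upwards [isOpen_compl_singleton.mem_nhds hs1] with z hz
      exact dedekindZeta₁_eq (K := K) hz
    have hprod : HasDerivAt (fun z ↦ (z - 1) * dedekindZetaCont K z)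
        (1 * dedekindZetaCont K s + (s - 1) * deriv (dedekindZetaCont K) s) s :=
      ((hasDerivAt_id s).sub_const 1).mul hζd.hasDerivAt
    have hderiv : deriv ζ₁[K] s =
        dedekindZetaCont K s + (s - 1) * deriv (dedekindZetaCont K) s := by
      rw [hev.deriv_eq, hprod.deriv, one_mul]
    have : deriv (dedekindZetaCont K) s / dedekindZetaCont K s + 1 / (s - 1) =
        deriv ζ₁[K] s / ζ₁[K] s := by
      rw [hderiv, heq]; field_simp; ring
    rwa [this]

end NumberField

end Literature.NumberTheory.LFunctions

end
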